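import Mathlib.FieldTheory.IntermediateField.Adjoin.Basic
import Literature.Barriers.Schanuel.AlgebraicIndependenceOfLogarithmsRationalLemmas
import Literature.Barriers.Schanuel.AlgebraicIndependenceOfLogarithmsRoyThm12
import HarnessLib

/-!
# Barrier (Schanuel): Roy 1992, Theorem 2 ⇒ Theorem 4 — admissible maps and the number field

Second support file for the deduction of Roy's Theorem 4 (`roy1992_thm4`) from his Theorem 2
(`roy1992_thm2`) [Roy1992, §4 pp. 34–37], continuing
`Literature.Barriers.Schanuel.AlgebraicIndependenceOfLogarithmsRationalLemmas` (rational structures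
`F^n ⊂ K^n`). Everything here is proved; the objects are those of the printed proof (p. 35):

* `Roy1992.exists_eq_prodMap_of_isAdmissible` — a map `s` admissible in Theorems 1–2
  (`IsAdmissible`: surjective, `s(ℚ̄^{d₀} × 0) ⊆ ℚ̄^{d₀'} × 0`, `s(0 × ℚ^{d₁}) ⊆ 0 × ℚ^{d₁'}`) is a
  product `s₀ × s₁` of a map given by a matrix over `ℚ̄` and one given by a matrix over `ℚ`, both
  surjective ("The above conditions on `s` show that its kernel is a product `S₀ × S₁`, where `S₀`
  is a subspace of `K^d` which is rational over `ℚ̄`, and where `S₁` is a subspace of `(K^d)^m`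
  which is rational over `ℚ`", p. 35).
* `Roy1992.isRationalMap_mulVecLin_map`, `Roy1992.exists_eq_mulVecLin_of_isRationalMap` — maps
  rational over `ℚ̄` (`IsRationalMap`) are exactly the maps given by matrices over `ℚ̄`.
* `Roy1992.exists_numberField_basis` — "Since `Z` is of finite dimension over `ℚ̄`, there exist a
  subfield `k` of `ℚ̄` of finite degree over `ℚ` and a `k`-vector subspace `Z₁` of `(k + k·L)^d`
  such that `Z = ℚ̄·Z₁`" (p. 35): a `ℚ̄`-basis of `Z ⊆ 𝓛̃^d` has all its entries in `k + k·L`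
  (`= span_k ({1} ∪ L)`) for some number field `k ⊂ ℂ`.
* `Roy1992.mem_algebraicClosure_of_mem_numberField` — `k ⊆ ℚ̄`.

## References

* [Roy1992] D. Roy, *Matrices whose coefficients are linear forms in logarithms*, J. Number
  Theory 41 (1992) 22–47: §4, proof of Theorem 4, p. 35.
-/

noncomputable section

open Module Submodule Complex

namespace Literature.Barriers.Schanuel.Roy1992

/-! ### Admissible maps are products of a `ℚ̄`-rational and a `ℚ`-rational map -/

/-- A linear map out of `K^n` vanishing on the standard basis vectors vanishes. [folklore] -/
theorem eq_zero_of_forall_single {K : Type*} [CommSemiring K] {n : ℕ} {E' : Type*}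
    [AddCommMonoid E'] [Module K E']
    (g : (Fin n → K) →ₗ[K] E') (hg : ∀ i, g (Pi.single i 1) = 0) : g = 0 := by
  refine LinearMap.pi_ext fun i c => ?_
  rw [LinearMap.zero_apply, ← mul_one c, ← smul_eq_mul, Pi.single_smul, map_smul, hg, smul_zero]

/-- **Admissible maps are products** (the first step of (5), p. 35): if
`s : K^{d₀} × K^{d₁} → K^{d₀'} × K^{d₁'}` is admissible (`IsAdmissible`: surjective,
`s(ℚ̄^{d₀} × 0) ⊆ ℚ̄^{d₀'} × 0`, `s(0 × ℚ^{d₁}) ⊆ 0 × ℚ^{d₁'}`), then `s = s₀ × s₁` with `s₀` given by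
a matrix over `ℚ̄`, `s₁` by a matrix over `ℚ`, both surjective; in particular
`ker s = ker s₀ × ker s₁` with `ker s₀` rational over `ℚ̄` and `ker s₁` rational over `ℚ`
(`ker_mulVecLin_map`). [cite: Roy1992, §4 proof of Theorem 4 (p. 35)] -/
theorem exists_eq_prodMap_of_isAdmissible {d₀ d₁ d₀' d₁' : ℕ}
    {s : LinTangent d₀ d₁ →ₗ[ℂ] LinTangent d₀' d₁'} (hs : IsAdmissible s) :
    ∃ (A₀ : Matrix (Fin d₀') (Fin d₀) (algebraicClosure ℚ ℂ)) (A₁ : Matrix (Fin d₁') (Fin d₁) ℚ),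
      s = (A₀.map (algebraMap (algebraicClosure ℚ ℂ) ℂ)).mulVecLin.prodMap
            (A₁.map (algebraMap ℚ ℂ)).mulVecLin ∧
      Function.Surjective (A₀.map (algebraMap (algebraicClosure ℚ ℂ) ℂ)).mulVecLin ∧
      Function.Surjective (A₁.map (algebraMap ℚ ℂ)).mulVecLin := by
  obtain ⟨hsurj, h0, h1⟩ := hs
  set s₀ : (Fin d₀ → ℂ) →ₗ[ℂ] (Fin d₀' → ℂ) :=
    LinearMap.fst ℂ _ _ ∘ₗ s ∘ₗ LinearMap.inl ℂ _ _ with hs₀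
  set s₁ : (Fin d₁ → ℂ) →ₗ[ℂ] (Fin d₁' → ℂ) :=
    LinearMap.snd ℂ _ _ ∘ₗ s ∘ₗ LinearMap.inr ℂ _ _ with hs₁
  have hsingle0 : ∀ i : Fin d₀, ∀ k, (Pi.single i (1 : ℂ) : Fin d₀ → ℂ) k ∈ algebraicClosure ℚ ℂ := by
    intro i k
    by_cases h : k = i
    · subst h; simp
    · simp [h]
  have hsingle1 : ∀ j : Fin d₁, ∀ k,
      (Pi.single j (1 : ℂ) : Fin d₁ → ℂ) k ∈ Set.range ((↑) : ℚ → ℂ) := by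
    intro j k
    by_cases h : k = j
    · subst h; exact ⟨1, by simp⟩
    · exact ⟨0, by simp [h]⟩
  -- the off-diagonal blocks vanish
  have hoff0 : (LinearMap.snd ℂ _ _ ∘ₗ s ∘ₗ LinearMap.inl ℂ _ (Fin d₁ → ℂ)) = 0 :=
    eq_zero_of_forall_single _ fun i => (h0 _ (hsingle0 i)).2
  have hoff1 : (LinearMap.fst ℂ _ _ ∘ₗ s ∘ₗ LinearMap.inr ℂ (Fin d₀ → ℂ) _) = 0 :=
    eq_zero_of_forall_single _ fun j => (h1 _ (hsingle1 j)).1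
  have hdec : ∀ x y, s (x, y) = (s₀ x, s₁ y) := by
    intro x y
    have hx : s (x, 0) = (s₀ x, 0) := by
      ext1
      · rfl
      · exact congrArg (fun f => f x) (congrArg DFunLike.coe hoff0)
    have hy : s (0, y) = (0, s₁ y) := by
      ext1
      · exact congrArg (fun f => f y) (congrArg DFunLike.coe hoff1)
      · rfl
    calc s (x, y) = s ((x, 0) + (0, y)) := by simp
      _ = (s₀ x, s₁ y) := by rw [map_add, hx, hy]; simp
  -- the matrices
  have hA₀mem : ∀ i j, LinearMap.toMatrix' s₀ i j ∈ algebraicClosure ℚ ℂ := by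
    intro i j
    rw [LinearMap.toMatrix'_apply]
    exact (h0 _ (hsingle0 j)).1 i
  have hA₁mem : ∀ i j, LinearMap.toMatrix' s₁ i j ∈ Set.range ((↑) : ℚ → ℂ) := by
    intro i j
    rw [LinearMap.toMatrix'_apply]
    exact (h1 _ (hsingle1 j)).2 i
  let A₀ : Matrix (Fin d₀') (Fin d₀) (algebraicClosure ℚ ℂ) := fun i j => ⟨_, hA₀mem i j⟩
  let A₁ : Matrix (Fin d₁') (Fin d₁) ℚ := fun i j => Classical.choose (hA₁mem i j)
  have hA₀ : A₀.map (algebraMap (algebraicClosure ℚ ℂ) ℂ) = LinearMap.toMatrix' s₀ := by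
    ext i j; rfl
  have hA₁ : A₁.map (algebraMap ℚ ℂ) = LinearMap.toMatrix' s₁ := by
    ext i j
    exact Classical.choose_spec (hA₁mem i j)
  have hm₀ : (A₀.map (algebraMap (algebraicClosure ℚ ℂ) ℂ)).mulVecLin = s₀ := by
    rw [hA₀, ← Matrix.toLin'_apply', Matrix.toLin'_toMatrix']
  have hm₁ : (A₁.map (algebraMap ℚ ℂ)).mulVecLin = s₁ := by
    rw [hA₁, ← Matrix.toLin'_apply', Matrix.toLin'_toMatrix']
  refine ⟨A₀, A₁, ?_, ?_, ?_⟩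
  · rw [hm₀, hm₁]
    refine LinearMap.ext fun p => ?_
    obtain ⟨x, y⟩ := p
    rw [hdec, LinearMap.prodMap_apply]
  · rw [hm₀]
    intro a
    obtain ⟨⟨x, y⟩, hxy⟩ := hsurj (a, 0)
    refine ⟨x, ?_⟩
    have := congrArg Prod.fst hxy
    rwa [hdec] at this
  · rw [hm₁]
    intro b
    obtain ⟨⟨x, y⟩, hxy⟩ := hsurj (0, b)
    refine ⟨y, ?_⟩
    have := congrArg Prod.snd hxy
    rwa [hdec] at this

/-! ### Maps rational over `ℚ̄` are the maps given by matrices over `ℚ̄` -/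

/-- A map given by a matrix with algebraic entries is rational over `ℚ̄`. [folklore] -/
theorem isRationalMap_mulVecLin_map {m n : ℕ} (A : Matrix (Fin m) (Fin n) (algebraicClosure ℚ ℂ)) :
    IsRationalMap (A.map (algebraMap (algebraicClosure ℚ ℂ) ℂ)).mulVecLin := by
  intro v hv j
  let v₀ : Fin n → algebraicClosure ℚ ℂ := fun i => ⟨v i, hv i⟩
  have hv₀ : v = incl (algebraicClosure ℚ ℂ) ℂ n v₀ := funext fun i => rfl
  rw [hv₀, map_mulVec_incl, incl_apply]
  exact SetLike.coe_mem _

/-- A map rational over `ℚ̄` is given by a matrix with algebraic entries. [folklore] -/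
theorem exists_eq_mulVecLin_of_isRationalMap {m n : ℕ} {t : (Fin n → ℂ) →ₗ[ℂ] (Fin m → ℂ)}
    (ht : IsRationalMap t) :
    ∃ A : Matrix (Fin m) (Fin n) (algebraicClosure ℚ ℂ),
      t = (A.map (algebraMap (algebraicClosure ℚ ℂ) ℂ)).mulVecLin := by
  refine ⟨fun i j => ⟨LinearMap.toMatrix' t i j, toMatrix'_mem_of_isRationalMap ht i j⟩, ?_⟩
  have h : (Matrix.map (fun i j => (⟨LinearMap.toMatrix' t i j, toMatrix'_mem_of_isRationalMap ht i j⟩ :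
      algebraicClosure ℚ ℂ)) (algebraMap (algebraicClosure ℚ ℂ) ℂ)) = LinearMap.toMatrix' t := by
    ext i j; rfl
  rw [h, ← Matrix.toLin'_apply', Matrix.toLin'_toMatrix']

/-! ### The number field of a finite-dimensional `ℚ̄`-subspace of `𝓛̃^d` -/

/-- Elements of a number field `k ⊂ ℂ` (an intermediate field of finite degree over `ℚ`) are
algebraic: `k ⊆ ℚ̄`. [folklore] -/
theorem mem_algebraicClosure_of_mem_numberField {k : IntermediateField ℚ ℂ} [FiniteDimensional ℚ k]
    {x : ℂ} (hx : x ∈ k) : x ∈ algebraicClosure ℚ ℂ := by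
  rw [mem_algebraicClosure_iff]
  have h : IsAlgebraic ℚ (⟨x, hx⟩ : k) := Algebra.IsAlgebraic.isAlgebraic _
  exact IntermediateField.isAlgebraic_iff.1 h

/-- **The number field of `Z`** ("there exist a subfield `k` of `ℚ̄` of finite degree over `ℚ` and a
`k`-vector subspace `Z₁` of `(k + k·L)^d` such that `Z = ℚ̄·Z₁`", p. 35): for a finite-dimensional
`ℚ̄`-subspace `Z` of `𝓛̃^d` (`𝓛̃ = logLinearForms = span_ℚ̄ ({1} ∪ L)`) there are a number field
`k ⊂ ℂ` and a `ℚ̄`-basis of `Z` all of whose entries lie in `k + k·L = span_k ({1} ∪ L)` (adjoin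
to `ℚ` the finitely many algebraic coefficients of the entries of a basis).
[cite: Roy1992, §4 proof of Theorem 4 (p. 35)] -/
theorem exists_numberField_basis {d : ℕ} (Z : Submodule (algebraicClosure ℚ ℂ) (Fin d → ℂ))
    [Module.Finite (algebraicClosure ℚ ℂ) Z] (hZ : ∀ z ∈ Z, ∀ i, z i ∈ logLinearForms) :
    ∃ (k : IntermediateField ℚ ℂ) (_ : FiniteDimensional ℚ k)
      (b : Basis (Fin (finrank (algebraicClosure ℚ ℂ) Z)) (algebraicClosure ℚ ℂ) Z),
      ∀ r i, (b r : Fin d → ℂ) i ∈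
        Submodule.span k ({1} ∪ {x : ℂ | IsAlgebraic ℚ (cexp x)}) := by
  let b : Basis (Fin (finrank (algebraicClosure ℚ ℂ) Z)) (algebraicClosure ℚ ℂ) Z :=
    finBasis (algebraicClosure ℚ ℂ) Z
  have hmem : ∀ r i, (b r : Fin d → ℂ) i ∈ logLinearForms := fun r i => hZ _ (b r).2 i
  simp only [logLinearForms, Submodule.mem_span_iff_exists_finset_subset] at hmem
  choose f t ht hsupp hsum using hmem
  -- the finitely many algebraic coefficients
  let C : Set ℂ := ⋃ r, ⋃ i, (fun a => (f r i a : ℂ)) '' (t r i : Set ℂ)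
  have hC : C.Finite := Set.finite_iUnion fun r => Set.finite_iUnion fun i =>
    (Finset.finite_toSet _).image _
  haveI : Finite C := hC.to_subtype
  have hCint : ∀ x ∈ C, IsIntegral ℚ x := by
    intro x hx
    simp only [C, Set.mem_iUnion, Set.mem_image] at hx
    obtain ⟨r, i, a, -, rfl⟩ := hx
    exact (IntermediateField.isAlgebraic_iff.1 (Algebra.IsAlgebraic.isAlgebraic (f r i a))).isIntegral
  let k : IntermediateField ℚ ℂ := IntermediateField.adjoin ℚ C
  haveI hk : FiniteDimensional ℚ k := IntermediateField.finiteDimensional_adjoin hCint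
  refine ⟨k, hk, b, fun r i => ?_⟩
  rw [← hsum r i]
  refine Submodule.sum_mem _ fun a ha => ?_
  have hfa : (f r i a : ℂ) ∈ k :=
    IntermediateField.subset_adjoin ℚ C (Set.mem_iUnion.2 ⟨r, Set.mem_iUnion.2 ⟨i, a, ha, rfl⟩⟩)
  have hsmul : f r i a • a = (⟨(f r i a : ℂ), hfa⟩ : k) • a := by
    rw [IntermediateField.smul_def, IntermediateField.smul_def]
  rw [hsmul]
  exact Submodule.smul_mem _ _ (Submodule.subset_span (ht r i ha))

end Literature.Barriers.Schanuel.Roy1992
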